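import Mathlib.Geometry.Manifold.Instances.Real
import Literature.Geometry.Riemannian.ConstantCurvature
import Literature.Geometry.Lorentzian.LeviCivita
import HarnessLib

/-!
# A closed hyperbolic 4-manifold exists (Davis 1985, the 120-cell manifold)

Topic `Literature/Topology/FourManifolds`; ONE named fact (a theorem in print, `def … : Prop`,
D-0014), filed by a grounder for route `SmoothPoincare4/CartanHadamardSwindle`, whose support item
`Summit.SmoothPoincare4.SmoothPoincare4.Theses.CartanHadamardSwindle.ExistsClosedHyperbolicFour`
(item `stmt-SmoothPoincare4-8101`, "a cite-level named fact") it grounds VERBATIM.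

* **Davis 1985** (Proc. Amer. Math. Soc. 93, 325–328, READ): abstract, p. 325: "There is a regular
  4-dimensional polyhedron with 120 dodecahedra as 3-dimensional faces. (Coxeter calls it the
  "120-cell".) […] For each pair of opposite 3-dimensional faces of this polyhedron there is a
  unique reflection in its symmetry group which interchanges them. The result of identifying
  opposite faces by these reflections is a hyperbolic manifold `M⁴`."; p. 327: "`K` is
  torsion-free. Consequently, `K` acts freely on `H⁴`, and `M⁴` is a hyperbolic 4-manifold"
  (`K ◁ G₄` of finite index in the discrete COCOMPACT reflection group `G₄ ⊂ O(4,1)` of the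
  hyperbolic 120-cell, p. 325, so `M⁴ = H⁴/K` is closed, connected, orientable, `χ = 26`).
  Further structure: Ratcliffe–Tschantz 2001.

## Rendering

* "Closed hyperbolic 4-manifold" = a compact connected boundaryless smooth 4-manifold modelled on
  `EuclideanSpace ℝ (Fin 4)` (`𝓡 4`), Hausdorff and second countable, carrying a `C^∞`
  Riemannian metric (the tree's `PseudoRiemannianMetric` with `IsRiemannian`) of constant
  sectional curvature `−1` (`HasConstantSectionalCurvature (-1)`, Lee Prop. 8.36 in the tree's
  `curvatureForm` sign, `ConstantCurvature.lean`) — the quotient metric of `H⁴/K`.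
* Pure existence; the Coxeter-group construction is not vendored (a Lean construction would pass
  through a torsion-free finite-index subgroup of the `[5,3,3,5]`-type reflection group).

## References

* M. W. Davis, *A hyperbolic 4-manifold*, Proc. Amer. Math. Soc. 93 (1985) 325–328: abstract and
  §3 (p. 327). [`Davis1985`]
* J. G. Ratcliffe, S. T. Tschantz, *On the Davis hyperbolic 4-manifold*, Topology Appl. 111 (2001)
  327–342. [`RatcliffeTschantz2001`]
-/

noncomputable section

open scoped Manifold ContDiff

namespace Literature.Topology.FourManifolds

/-- **There is a closed hyperbolic 4-manifold** (Davis 1985: identifying opposite dodecahedral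
faces of the hyperbolic 120-cell by reflections gives "a hyperbolic manifold `M⁴`"; "`K` is
torsion-free. Consequently, `K` acts freely on `H⁴`, and `M⁴` is a hyperbolic 4-manifold", `K`
of finite index in a cocompact reflection group, so `M⁴` is closed): there is a compact connected
smooth 4-manifold with a `C^∞` Riemannian metric of constant sectional curvature `−1`. Grounds
`Summit.SmoothPoincare4.SmoothPoincare4.Theses.CartanHadamardSwindle.ExistsClosedHyperbolicFour`
(item `stmt-SmoothPoincare4-8101`) verbatim. [cite: Davis1985, Abstract and §3 (p. 327)] -/
def Davis1985_exists_closed_hyperbolic_four : Prop :=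
  ∃ (X : Type) (_ : TopologicalSpace X) (_ : T2Space X) (_ : SecondCountableTopology X)
    (_ : ChartedSpace (EuclideanSpace ℝ (Fin 4)) X) (_ : IsManifold (𝓡 4) ∞ X) (_ : CompactSpace X)
    (_ : ConnectedSpace X)
    (g : Literature.Geometry.Lorentzian.PseudoRiemannianMetric (𝓡 4) ∞ (EuclideanSpace ℝ (Fin 4))
      (TangentSpace (𝓡 4) : X → Type _)),
    g.IsRiemannian ∧ g.HasConstantSectionalCurvature (-1)

end Literature.Topology.FourManifolds
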